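import Summits.BirchSwinnertonDyer.BirchSwinnertonDyer.Theorems.UniversalToricDescentToricKernelAtThreeApZeroOddOfPoitouTate
import Summits.BirchSwinnertonDyer.BirchSwinnertonDyer.Theorems.UniversalToricDescentTwinFullThreeAdicImageOverK
import Summits.BirchSwinnertonDyer.BirchSwinnertonDyer.Theses.UniversalToricDescent
import HarnessLib

/-!
# Route `UniversalToricDescent` — the rev-31 kernel `ToricKernelAtThreeApZeroOddOfPrint` (item
# stmt-BirchSwinnertonDyer-24911) HOLDS

Cell `bsd-wall` (W-ALL lane 3, row 2·3@3), seat `bsd-wall-tqs-p1-w2` g7 executing the UTD pen's ticket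
`utdC/TICKET-C.md` (planner pss3x g3, act C + bucket-A one-fact re-key; certified scratch `utdC/SketchC.lean`
§K, landed verbatim up to the import of the route file, which now declares the three rev-31 packages
`TwinSplitIMCAtThreeNonOrdBuckets`, `ToricPrintedLeavesAtThree`, `ToricKernelAtThreeApZeroOddOfPrint`).

The item's text is 24477 `ToricKernelAtThreeApZeroOdd` (CLOSED, p595754) with
`TwinSplitIMCAtThreePrintedFacts → TwinSplitIMCAtThreeGoodOrdOfPrint → TwinSplitIMCAtThreeMult →
TwinSplitIMCAtThreeGoodSSApZero →` replaced by `TwinSplitIMCAtThreeNonOrdBuckets →`, `WildSplitControlAtThree →`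
deleted, and the printed leaves `ToricPrintedLeavesAtThree →` (Yan–Zhu 5.7(1) ∧ Poitou–Tate ×2) inserted after the
E-port. Proof: §3 of p595754 re-run with the good-ordinary bucket discharged by Yan–Zhu 5.7(1) ALONE
(`ThreeAdicImageOverK.twinSplitIMCAtThreeGoodOrd_of_yanZhu57`, p596097/p596245), crux #5 (control) from the two
Poitou–Tate leaves (`UniversalToricDescentControl.wildSplitControlAtThree_of_poitouTate`, utd-p3 g5), and V♯ from
LZZ + the E-port exactly as in `toricKernelAtThreeApZeroOdd_proof`.

What this does NOT do: it proves no research binder of the route (`ToricTransportModThree`,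
`TwinSplitIMCAtThreeNonOrdBuckets`, `WildRankZeroTwistAtThree` stay OPEN) and no printed package; BSD is not
proved by any of this.
-/

noncomputable section

open scoped Classical

set_option linter.dupNamespace false
set_option autoImplicit false

namespace Summit.BirchSwinnertonDyer.BirchSwinnertonDyer.Theorems.UniversalToricDescentKernelOfPrint

open WeierstrassCurve NumberField IsDedekindDomain Field
  Literature.NumberTheory.EllipticCurves
  Literature.NumberTheory.EllipticCurves.ModularForms
  Literature.NumberTheory.EllipticCurves.Rank1Residual
  Literature.NumberTheory.EllipticCurves.KrizLi2019
  Literature.NumberTheory.EllipticCurves.LiuZhangZhang2018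
  Summit.BirchSwinnertonDyer.Rank1Residual
  Summit.BirchSwinnertonDyer.Rank1Residual.Additive
  Summit.BirchSwinnertonDyer.Rank1Residual.X11b
  Summit.BirchSwinnertonDyer.Rank1Residual.X11b.AcSelmer
  Summit.BirchSwinnertonDyer.Rank1Residual.X11b.Halves
  Summit.BirchSwinnertonDyer.BirchSwinnertonDyer.Theses.UniversalToricDescent
  Summit.BirchSwinnertonDyer.BirchSwinnertonDyer.Theorems
  Summit.BirchSwinnertonDyer.BirchSwinnertonDyer.Theorems.UniversalToricDescentTwinChoice
  Summit.BirchSwinnertonDyer.BirchSwinnertonDyer.Theorems.UniversalToricDescentWaldspurgerFlat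
  Summit.BirchSwinnertonDyer.BirchSwinnertonDyer.Theorems.UniversalToricDescentKernelOdd

/-- §3 of `UniversalToricDescentToricKernelAtThreeApZeroOdd` (utd-p3 g7, p595754) re-run with bucket A supplied by
Yan–Zhu 5.7(1) ALONE through utd-p2 g9's `ThreeAdicImageOverK.twinSplitIMCAtThreeGoodOrd_of_yanZhu57`
(p596097/p596245) in place of `(hP : TwinSplitIMCAtThreePrintedFacts) (hA : TwinSplitIMCAtThreeGoodOrdOfPrint)`;
every other line verbatim. [folklore] -/
theorem bsdp_three_of_apZero_of_cellSupply_odd_of_yanZhu (hF : ToricPublishedInputs)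
    (hT : ToricTransportModThree) (hYZ : YanZhuMainConjectureInput) (hB : TwinSplitIMCAtThreeMult)
    (hS0 : ∀ (W' : WeierstrassCurve ℚ) [W'.IsElliptic] [W'.IsGloballyMinimal],
      GoodSS W' 3 → W'.frobeniusTrace 3 = 0 → W'.HasSurjectiveModNGaloisRep 3 → TwinIMCAtThreeAt W')
    (hsupply : ∀ (W : WeierstrassCurve ℚ) [W.IsElliptic] [W.IsGloballyMinimal], Additive.ClassO6 W 3 →
      W.analyticRank = 1 → W.HasSurjectiveModNGaloisRep 3 → HasGoodSSTwinAtThree W →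
      HasGoodSSApZeroTwinAtThree W)
    (hV : ∀ (W : WeierstrassCurve ℚ) [W.IsElliptic] [W.IsGloballyMinimal] (N : ℕ) [NeZero N] (K : Type)
      [Field K] [NumberField K] (Dt : ModularParametrizationData W N) (H : HeegnerDatum N (NumberField.discr K))
      (ι : K →+* ℂ) (P : (W.baseChange K).toAffine.Point),
      Additive.ClassO6 W 3 → W.HasSurjectiveModNGaloisRep 3 → W.analyticRank = 1 → W.conductorNorm ℤ = N →
      IsImaginaryQuadratic K → SatisfiesHeegnerHypothesis N K → Odd (NumberField.discr K) →
      (W.quadraticTwist (NumberField.discr K : ℚ)).entireLFunction 1 ≠ 0 →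
      (WeierstrassCurve.Affine.Point.map ι.toRatAlgHom) P = heegnerPointComplex Dt H → ¬ IsOfFinAddOrder P →
      ∀ (κ : ZpExtension K 3), κ.IsAnticyclotomic → ∀ (γ : absoluteGaloisGroup K) [Fact (κ.IsTopGenerator γ)]
        (𝔭 : HeightOneSpectrum (𝓞 K)) (h𝔭 : ((3 : ℕ) : 𝓞 K) ∈ 𝔭.asIdeal)
        (he : 𝔭.asIdeal.ramificationIdx (𝓞 ℚ) = 1) (hf : 𝔭.asIdeal.inertiaDeg (𝓞 ℚ) = 1),
        ∃ ι' : PadicAlgCl 3 ≃+* ℂ, SchneiderFree.BranchInducesPrime 3 ι' 𝔭 ∧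
          ∃ (ΩK : ℂ) (Ωp : ℂ_[3]) (L : UnrSeries 3), ΩK ≠ 0 ∧ Ωp ≠ 0 ∧ IsBDPLFunction ι' 𝔭 κ γ Dt.f ΩK Ωp L ∧
            ∃ u : (unrIntegers 3)ˣ, L.HasValueAt 0 ((((u : unrIntegers 3) : unrIntegers 3) : ℂ_[3]) *
              (algebraMap ℚ_[3] ℂ_[3] (logOmega W 3 (embAt K 3 𝔭 h𝔭 he hf) P / (Dt.c : ℚ_[3]))) ^ 2))
    (hC : WildSplitControlAtThree) (hZ : WildRankZeroTwistAtThree) :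
    ∀ (W : WeierstrassCurve ℚ) [W.IsElliptic] [W.IsGloballyMinimal], Additive.ClassO6 W 3 →
      W.analyticRank = 1 → W.HasSurjectiveModNGaloisRep 3 →
      (∃ (W' : WeierstrassCurve ℚ) (_ : W'.IsElliptic) (_ : W'.IsGloballyMinimal),
        O6.ModPCongruent W' W 3 ∧ ¬ Addv W' 3 ∧ W'.HasSurjectiveModNGaloisRep 3) → BSDp W 3 := by
  intro W _ _ hO6 hr hsurj htwin
  obtain ⟨W', hW'e, hW'm, hcong, hW'ss, hW'surj⟩ := htwin
  by_cases hgood : W'.HasGoodReductionAtPrime 3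
  · by_cases hss : (3 : ℤ) ∣ W'.frobeniusTrace 3
    · -- good supersingular: trade `W′` for the supplied `a₃ = 0` twin `W″`
      obtain ⟨W'', hW''e, hW''m, hcong'', hW''ss, ha0⟩ :=
        hsupply W hO6 hr hsurj ⟨W', hW'e, hW'm, hcong, hgood, by exact_mod_cast hss⟩
      have hW''surj : W''.HasSurjectiveModNGaloisRep 3 := by
        obtain ⟨e, he⟩ := hcong''
        refine GaloisImage.hasSurjectiveModNGaloisRep_of_torsionIso e.symm (fun σ Q ↦ ?_) hsurj
        apply e.injective
        rw [he, e.apply_symm_apply, e.apply_symm_apply]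
      exact bsdp_three_of_twinIMCAtThreeAt_odd hF hT hV hC hZ W hO6 hr hsurj W'' hcong'' (fun h ↦ h.1 hW''ss.1)
        (hS0 W'' hW''ss ha0 hW''surj)
    · -- good ordinary: bucket A from Yan–Zhu 5.7(1) alone (utd-p2 g9)
      refine bsdp_three_of_twinIMCAtThreeAt_odd hF hT hV hC hZ W hO6 hr hsurj W' hcong hW'ss ?_
      intro N' _ K _ _ Dt' hN hK hH hodd κ hκ γ _ 𝔭 h𝔭 he hf 𝔭' h𝔭' hne ι' hι
      exact ThreeAdicImageOverK.twinSplitIMCAtThreeGoodOrd_of_yanZhu57 hYZ W' N' K Dt'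
        ⟨hgood, by exact_mod_cast hss⟩ hW'surj hN hK hH hodd κ hκ γ 𝔭 h𝔭 he hf 𝔭' h𝔭' hne ι' hι
  · -- multiplicative: bucket B
    have hmult : W'.HasMultiplicativeReductionAtPrime 3 := by
      by_contra h
      exact hW'ss ⟨hgood, h⟩
    exact bsdp_three_of_twinIMCAtThreeAt_odd hF hT hV hC hZ W hO6 hr hsurj W' hcong hW'ss
      (twinSplitIMCAtThreeMult_iff.1 hB W' hmult hW'surj)

/-- **The rev-31 kernel item `ToricKernelAtThreeApZeroOddOfPrint` (stmt-BirchSwinnertonDyer-24911) holds**: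
unpack the two packages, derive control (crux #5) from the two Poitou–Tate leaves by utd-p3 g5's
`UniversalToricDescentControl.wildSplitControlAtThree_of_poitouTate`, V♯ from LZZ + the E-port as in
`toricKernelAtThreeApZeroOdd_proof`, and run the §3 re-run above. The type is literally the route decl.
[folklore] -/
theorem toricKernelAtThreeApZeroOddOfPrint_proof :
    Summit.BirchSwinnertonDyer.BirchSwinnertonDyer.Theses.UniversalToricDescent.ToricKernelAtThreeApZeroOddOfPrint := by
  intro hF hT h3 hsupply hW hS hL hZ
  obtain ⟨hB, hS0⟩ := h3
  obtain ⟨hYZ, h1, h2⟩ := hL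
  obtain ⟨hH, hB', hLZZ⟩ := hW
  exact bsdp_three_of_apZero_of_cellSupply_odd_of_yanZhu hF hT hYZ hB
    (fun W' _ _ hss ha hsurj N' _ K _ _ Dt' hN hK hHK hodd κ hκ γ _ 𝔭 h𝔭 he hf 𝔭' h𝔭' hne ι' hι ↦
      hS0 W' N' K Dt' hss ha hsurj hN hK hHK hodd κ hκ γ 𝔭 h𝔭 he hf 𝔭' h𝔭' hne ι' hι)
    (fun W _ _ hO6 hr hsurj htwin ↦ hsupply W hO6 hr hsurj htwin)
    (UniversalToricDescentKernelOdd.wildSplitWaldspurgerAtThreeOdd_of_lzz_of_frameOdd hLZZ (hS hH hB'))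
    (UniversalToricDescentControl.wildSplitControlAtThree_of_poitouTate h1 h2) hZ

/-- The route's `closes` body with its kernel hypothesis DISCHARGED by `toricKernelAtThreeApZeroOddOfPrint_proof`:
the registered leaf `WAllExclAddWildRankOneSurjTwin` from the eight remaining displayed hypotheses of
route `UniversalToricDescent` rev 31 (CONDITIONAL on every one of them; closes nothing by itself). [folklore] -/
theorem wAllExclAddWildRankOneSurjTwin_of_nonOrdBuckets_of_print
    (hF : ToricPublishedInputs) (hT : ToricTransportModThree)
    (h3 : TwinSplitIMCAtThreeNonOrdBuckets) (hsupply : GoodSSApZeroTwinSupplyAtThree)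
    (hW : WildSplitPrintedInputsAtThree) (hS : WildSplitFrameAtThreeOddOfPrint)
    (hL : ToricPrintedLeavesAtThree) (hZ : WildRankZeroTwistAtThree) :
    Summit.BirchSwinnertonDyer.WAllExclAddWildRankOneSurjTwin :=
  Summit.BirchSwinnertonDyer.wAllExclAddWildRankOneSurjTwin_of_forall
    (toricKernelAtThreeApZeroOddOfPrint_proof hF hT h3 hsupply hW hS hL hZ)

end Summit.BirchSwinnertonDyer.BirchSwinnertonDyer.Theorems.UniversalToricDescentKernelOfPrint

end
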